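import Literature.MathematicalPhysics.QuantumFieldTheory.Balaban1983to89.Node00.OpsYDeltaA
import Literature.MathematicalPhysics.QuantumFieldTheory.Balaban1983to89.B9GeoLemma21KLevelV1

/-!
# `Balaban1983to89.B9RecordDELettersVacuity` — at def-Y's INSTANCE OF RECORD (`Node00.opsYOfRecord`, p484082) the Sect. D∕E letters are the
# flat ZERO placeholders, so the N06 knit's rows 25 ((3.49)) and 26 ((3.132)) READ ZERO and their printed leaves hold VACUOUSLY — located

T. Bałaban, *Propagators for lattice gauge theories in a background field*, Commun. Math. Phys. **99** (1985) 389–434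
[`Balaban1985BackgroundPropagators`, "B9"].

statement-level skeleton of published theorems with citation tags; proofs where landed; nothing here is a claim about the
Yang–Mills mass gap

THE POINT.  def-Y v2 (`Node00/OpsYDeltaA.lean` §6–§7) names THE LETTERS OF RECORD `lettersYOfRecord N θ M⋆ = covLettersY_v2 …` with
GENUINE `parS parB Gp GA C` and — verbatim from its docstring — *"the Sect. D∕E letters (`GD, G₁, GG, Kdiff, H, H₁, Ck, QGQinv, QG1Qinv,
P349`) remain the flat `0` placeholders of `covLettersY_flat`"*.  Consequently, at `ops := opsYOfRecord N θ M⋆ 𝔈`, the (3.49) reading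
`(ops x).P349` and the (3.132) readings `(ops x).QGQinv`, `(ops x).QG1Qinv` are IDENTICALLY ZERO, and the printed family leaves
`B9.Stmt349Printed` (row 25, `s349`) and `B9.Stmt3132Printed` (row 26, `s3132`) hold with any positive constants.  THIS FILE records that
LOCATED VACUITY (the analogue of row 14's `hg_obligation_vacuous`), so that a knit at `opsYOfRecord` supplying rows 25–26 this way is
read for what it is: NO content of [B9] — the rows become contentful only when the D∕E letters are CONSTRUCTED ((3.25) `P = I − R` on the
site sector; `(QGQ*)⁻¹ := Ring.inverse (QGQ*)`, for which `B9Eq3132RingInverseReading` (p482854) is the non-vacuous route).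

* §1 `siteKernelOfOp_zero_ker`, `cdB_zero`, `cdsB_zero`, `supInB_zero`, `fineKernelOfOp_zero_ker` — the readings of a zero letter are `0`.
* §2 `stmt349Printed_of_ker_zero`, `stmt3132Printed_of_ker_zero` — the family leaves hold vacuously for kernels reading `0` (lengths ≥ 0).
* §3 `lettersYOfRecord_P349 ∕ _QGQinv ∕ _QG1Qinv` (`= fun _ => 0`, `rfl`), `opsYOfRecord_P349_ker ∕ _QGQinv_ker ∕ _QG1Qinv_ker` (`= 0`),
  ★ `s349_opsYOfRecord_vacuous`, ★ `s3132_opsYOfRecord_vacuous` — rows 25, 26 at the instance of record, for every `d′`, `c35`, `𝔈`.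

HONEST SCOPE.  A vacuity certificate: nothing of print is asserted or used; it says the record's rows 25–26 are EMPTY as the letters stand.
Count-neutral; NOT a node discharge; one finite lattice programme; nothing continuum, nothing about the mass gap.  Cell `pub-ymgap`
(HUMAN RULING D-0062), Track A node N06 [B9], N06-ASSIGNMENT v1 rows 25–26 (bundle F4), seat `pub-ymgap-dag-n06-i` gen 4, 2026-08-27.
-/

noncomputable section

namespace Literature.MathematicalPhysics.QuantumFieldTheory.Balaban1983to89.B9RecordDELettersVacuity

open Node00
open B6KLevelCensusIndexV1 (KIdx)
open B9PinMembersKLevelV1 (MemberY geo9Y bg9Y)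
open B9GeoLemma21KLevelV1 (geo9Y_len_pos)
open B7Prop2SpecialUnitary (specialUnitaryUnits)

variable {d ℓ : ℕ} {hd : 1 ≤ d + 1} {hL : Odd (ℓ + 1) ∧ 1 < ℓ + 1} {b₀ b₁ : ℝ} {Mstar : ℕ}
variable {𝔸 : Type} [NormedRing 𝔸] [NormedAlgebra ℂ 𝔸] [CompleteSpace 𝔸]

/-! ## §1 The readings of a ZERO letter are zero -/

section ZeroReadings

variable (i : KIdx d ℓ hd hL b₀ b₁) (B : B9.Backgrounds) (cfg : B.Cfg → CfgY 𝔸 i)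

/-- the (3.48)∕(3.132)∕(3.187) reading of the zero letter is `0`. [cite: Balaban1985BackgroundPropagators, (3.132) p.422, bookkeeping] -/
theorem siteKernelOfOp_zero_ker {X Y : Type} (ix : IBondY i → X) (iy : IBondY i → Y) (U : B.Cfg) (c c' : IBondY i) :
    (siteKernelOfOp i B cfg (fun _ => (0 : (Y → 𝔸) →ₗ[ℂ] (X → 𝔸))) ix iy).ker U c c' = 0 := by
  show (⨆ E : BallY 𝔸, ‖((0 : (Y → 𝔸) →ₗ[ℂ] (X → 𝔸)) (deltaY (iy c') (E : 𝔸))) (ix c)‖) = 0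
  simp

/-- the bond-sector covariant derivative of the zero function is zero. [cite: Balaban1985BackgroundPropagators, (3.3) p.390, bookkeeping] -/
theorem cdB_zero (U : CfgY 𝔸 i) (μ : Fin (d + 1)) : cdB i U μ (0 : FBondY i → 𝔸) = 0 := by
  funext b
  simp [cdB, B9Eq39Adjoint.covD]

/-- the bond-sector adjoint covariant derivative of the zero function is zero. [cite: Balaban1985BackgroundPropagators, (3.8) p.392, bookkeeping] -/
theorem cdsB_zero (U : CfgY 𝔸 i) (μ : Fin (d + 1)) : cdsB i U μ (0 : FBondY i → 𝔸) = 0 := by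
  funext b
  simp [cdsB, B9Eq39Adjoint.covDstar]

omit [NormedAlgebra ℂ 𝔸] [CompleteSpace 𝔸] in
/-- the block sup of the zero bond function is `0`. [cite: Balaban1985BackgroundPropagators, (3.42) p.397, bookkeeping] -/
theorem supInB_zero (y : BlkY i) : supInB i y (0 : FBondY i → 𝔸) = 0 := by
  simp [supInB]

/-- the (3.49) reading of the zero letter is `0` (all four entries). [cite: Balaban1985BackgroundPropagators, (3.49) p.399, bookkeeping] -/
theorem fineKernelOfOp_zero_ker (n : Fin 4) (U : B.Cfg) (y y' : IBondY i) :
    (fineKernelOfOp i B cfg (fun _ => (0 : (FBondY i → 𝔸) →ₗ[ℂ] (FBondY i → 𝔸)))).ker n U y y' = 0 := by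
  show (⨆ E : BallY 𝔸, ⨆ x' : {x : FBondY i // B6GlobalChartV1.blkV1 i.hN i.D x = B6Ineq2142KLevelV1.β i.hN i.D i.hk y'},
    ((![supInB i (B6Ineq2142KLevelV1.β i.hN i.D i.hk y) ((0 : (FBondY i → 𝔸) →ₗ[ℂ] (FBondY i → 𝔸)) (deltaY x'.1 (E : 𝔸))),
        ⨆ μ : Fin (d + 1), supInB i (B6Ineq2142KLevelV1.β i.hN i.D i.hk y)
          (cdB i (cfg U) μ ((0 : (FBondY i → 𝔸) →ₗ[ℂ] (FBondY i → 𝔸)) (deltaY x'.1 (E : 𝔸)))),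
        ⨆ ν : Fin (d + 1), supInB i (B6Ineq2142KLevelV1.β i.hN i.D i.hk y)
          ((0 : (FBondY i → 𝔸) →ₗ[ℂ] (FBondY i → 𝔸)) (cdsB i (cfg U) ν (deltaY x'.1 (E : 𝔸)))),
        ⨆ μ : Fin (d + 1), ⨆ ν : Fin (d + 1), supInB i (B6Ineq2142KLevelV1.β i.hN i.D i.hk y)
          (cdB i (cfg U) μ ((0 : (FBondY i → 𝔸) →ₗ[ℂ] (FBondY i → 𝔸)) (cdsB i (cfg U) ν (deltaY x'.1 (E : 𝔸)))))] :
      Fin 4 → ℝ) n)) = 0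
  have h0 : ∀ (E : BallY 𝔸) (x' : FBondY i),
      ((![supInB i (B6Ineq2142KLevelV1.β i.hN i.D i.hk y) ((0 : (FBondY i → 𝔸) →ₗ[ℂ] (FBondY i → 𝔸)) (deltaY x' (E : 𝔸))),
        ⨆ μ : Fin (d + 1), supInB i (B6Ineq2142KLevelV1.β i.hN i.D i.hk y)
          (cdB i (cfg U) μ ((0 : (FBondY i → 𝔸) →ₗ[ℂ] (FBondY i → 𝔸)) (deltaY x' (E : 𝔸)))),
        ⨆ ν : Fin (d + 1), supInB i (B6Ineq2142KLevelV1.β i.hN i.D i.hk y)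
          ((0 : (FBondY i → 𝔸) →ₗ[ℂ] (FBondY i → 𝔸)) (cdsB i (cfg U) ν (deltaY x' (E : 𝔸)))),
        ⨆ μ : Fin (d + 1), ⨆ ν : Fin (d + 1), supInB i (B6Ineq2142KLevelV1.β i.hN i.D i.hk y)
          (cdB i (cfg U) μ ((0 : (FBondY i → 𝔸) →ₗ[ℂ] (FBondY i → 𝔸)) (cdsB i (cfg U) ν (deltaY x' (E : 𝔸)))))] :
      Fin 4 → ℝ) n) = 0 := by
    intro E x'
    fin_cases n <;> simp [LinearMap.zero_apply, cdB_zero, supInB_zero]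
  simp_rw [h0]
  simp

end ZeroReadings

/-! ## §2 The printed leaves (3.49), (3.132) hold VACUOUSLY for kernels that read identically zero -/

section Vacuous

variable {I : Type} {geo : I → B9.Geometry} {bg : I → B9.Backgrounds}

/-- the (3.49) prefactors are non-negative at a non-negative length. [cite: Balaban1985BackgroundPropagators, (3.49) p.399, bookkeeping] -/
private theorem pref4inv_nonneg {t : ℝ} (ht : 0 ≤ t) (n : Fin 4) : 0 ≤ B9.pref4inv t n := by
  have h1 : 0 ≤ t⁻¹ := inv_nonneg.mpr ht
  fin_cases n <;> simp [B9.pref4inv, h1, pow_two, mul_nonneg h1 h1]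

/-- **(3.49) AS A FAMILY LEAF HOLDS VACUOUSLY FOR A KERNEL THAT READS ZERO** (any geometry with non-negative lengths, any backgrounds,
any c35; constants M₁ = δ₀ = a₀ = C = 1) — the located status of row 25 at an instance whose letter `P` is the flat zero.
[cite: Balaban1985BackgroundPropagators, (3.49) p.399 (statement shape; vacuity bookkeeping)] -/
theorem stmt349Printed_of_ker_zero (d : ℕ) (c35 : ℝ) (P : ∀ i, B9.FineKernel (geo i) (bg i))
    (hP : ∀ i n U y y', (P i).ker n U y y' = 0) (hlen : ∀ (i : I) (y : (geo i).Site), 0 ≤ (geo i).len y) :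
    B9.Stmt349Printed d c35 geo bg P := by
  refine ⟨1, 1, 1, 1, one_pos, one_pos, one_pos, one_pos, fun i _ α₀ _ _ U _ n y y' => ?_⟩
  rw [hP]
  exact mul_nonneg (mul_nonneg (mul_nonneg zero_le_one (pref4inv_nonneg (hlen i y) n)) (Real.rpow_nonneg (hlen i y') _))
    (Real.exp_nonneg _)

/-- **(3.132) AS A FAMILY LEAF HOLDS VACUOUSLY FOR KERNELS THAT READ ZERO** (constants M₄ = δ₁ = a₀ = C = 1) — the located status
of row 26 at an instance whose letters `(QGQ*)⁻¹`, `(QG₁Q*)⁻¹` are the flat zeros.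
[cite: Balaban1985BackgroundPropagators, (3.132) p.422 (statement shape; vacuity bookkeeping)] -/
theorem stmt3132Printed_of_ker_zero (d : ℕ) (c35 : ℝ) (K K₁ : ∀ i, B9.SiteKernel (geo i) (bg i))
    (hK : ∀ i U y y', (K i).ker U y y' = 0) (hK₁ : ∀ i U y y', (K₁ i).ker U y y' = 0)
    (hlen : ∀ (i : I) (y : (geo i).Site), 0 ≤ (geo i).len y) :
    B9.Stmt3132Printed d c35 geo bg K K₁ := by
  have hrhs : ∀ (i : I) (U : (bg i).Cfg) (y y' : (geo i).Site),
      0 ≤ 1 * (geo i).len y ^ (-(2 : ℝ)) * (geo i).len y' ^ (-(d : ℝ)) * Real.exp (-(1 * (geo i).dist y y')) :=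
    fun i U y y' => mul_nonneg (mul_nonneg (mul_nonneg zero_le_one (Real.rpow_nonneg (hlen i y) _))
      (Real.rpow_nonneg (hlen i y') _)) (Real.exp_nonneg _)
  refine ⟨1, 1, 1, 1, one_pos, one_pos, one_pos, one_pos, fun i _ α₀ _ _ U _ _ => ⟨fun y y' => ?_, fun y y' => ?_⟩⟩
  · rw [hK, abs_zero]; exact hrhs i U y y'
  · rw [hK₁, abs_zero]; exact hrhs i U y y'

end Vacuous

/-! ## §3 At def-Y's instance of record (p484082): the Sect. D∕E letters are the flat zeros, so rows 25–26 read zero -/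

section Record

open scoped Matrix.Norms.L2Operator

variable {N : ℕ}

/-- the record's `P = I − R` letter is the flat zero placeholder (`covLettersY_flat.P349`, kept by every v2 update).
[cite: Balaban1985BackgroundPropagators, (3.49) p.399 (the letter), bookkeeping] -/
theorem lettersYOfRecord_P349 (θ : Stage3Params) (Mstar : ℕ) (x : MemberY θ.d₆ θ.ℓ₆ θ.hd' θ.hL' θ.b₀ θ.b₁ Mstar) :
    (lettersYOfRecord N θ Mstar x).P349 = fun _ => 0 := rfl

/-- the record's `(QGQ*)⁻¹` letter is the flat zero placeholder. [cite: Balaban1985BackgroundPropagators, (3.132) p.422 (the letter), bookkeeping] -/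
theorem lettersYOfRecord_QGQinv (θ : Stage3Params) (Mstar : ℕ) (x : MemberY θ.d₆ θ.ℓ₆ θ.hd' θ.hL' θ.b₀ θ.b₁ Mstar) :
    (lettersYOfRecord N θ Mstar x).QGQinv = fun _ => 0 := rfl

/-- the record's `(QG₁Q*)⁻¹` letter is the flat zero placeholder. [cite: Balaban1985BackgroundPropagators, (3.132) p.422 (the letter), bookkeeping] -/
theorem lettersYOfRecord_QG1Qinv (θ : Stage3Params) (Mstar : ℕ) (x : MemberY θ.d₆ θ.ℓ₆ θ.hd' θ.hL' θ.b₀ θ.b₁ Mstar) :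
    (lettersYOfRecord N θ Mstar x).QG1Qinv = fun _ => 0 := rfl

/-- at the instance of record the (3.49) reading of `P` is identically zero. [cite: Balaban1985BackgroundPropagators, (3.49) p.399, bookkeeping] -/
theorem opsYOfRecord_P349_ker (θ : Stage3Params) (Mstar : ℕ) (𝔈 : ExpsY N θ Mstar)
    (x : MemberY θ.d₆ θ.ℓ₆ θ.hd' θ.hL' θ.b₀ θ.b₁ Mstar) (n : Fin 4)
    (U : (bg9Y (Matrix (Fin N) (Fin N) ℂ) (specialUnitaryUnits (Fin N)) x).Cfg) (y y' : (geo9Y x).Site) :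
    ((opsYOfRecord N θ Mstar 𝔈) x).P349.ker n U y y' = 0 := by
  have h1 : ((opsYOfRecord N θ Mstar 𝔈) x).P349 =
      fineKernelOfOp x.toKIdx (bg9Y (Matrix (Fin N) (Fin N) ℂ) (specialUnitaryUnits (Fin N)) x) (fun U => U)
        (lettersYOfRecord N θ Mstar x).P349 := rfl
  rw [h1, lettersYOfRecord_P349]
  exact fineKernelOfOp_zero_ker x.toKIdx (bg9Y (Matrix (Fin N) (Fin N) ℂ) (specialUnitaryUnits (Fin N)) x) (fun U => U) n U y y'

/-- at the instance of record the (3.132) reading of `(QGQ*)⁻¹` is identically zero. [cite: Balaban1985BackgroundPropagators, (3.132) p.422, bookkeeping] -/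
theorem opsYOfRecord_QGQinv_ker (θ : Stage3Params) (Mstar : ℕ) (𝔈 : ExpsY N θ Mstar)
    (x : MemberY θ.d₆ θ.ℓ₆ θ.hd' θ.hL' θ.b₀ θ.b₁ Mstar)
    (U : (bg9Y (Matrix (Fin N) (Fin N) ℂ) (specialUnitaryUnits (Fin N)) x).Cfg) (y y' : (geo9Y x).Site) :
    ((opsYOfRecord N θ Mstar 𝔈) x).QGQinv.ker U y y' = 0 := by
  have h1 : ((opsYOfRecord N θ Mstar 𝔈) x).QGQinv =
      siteKernelOfOp x.toKIdx (bg9Y (Matrix (Fin N) (Fin N) ℂ) (specialUnitaryUnits (Fin N)) x) (fun U => U)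
        (lettersYOfRecord N θ Mstar x).QGQinv id id := rfl
  rw [h1, lettersYOfRecord_QGQinv]
  exact siteKernelOfOp_zero_ker x.toKIdx (bg9Y (Matrix (Fin N) (Fin N) ℂ) (specialUnitaryUnits (Fin N)) x) (fun U => U) id id U y y'

/-- at the instance of record the (3.132) reading of `(QG₁Q*)⁻¹` is identically zero. [cite: Balaban1985BackgroundPropagators, (3.132) p.422, bookkeeping] -/
theorem opsYOfRecord_QG1Qinv_ker (θ : Stage3Params) (Mstar : ℕ) (𝔈 : ExpsY N θ Mstar)
    (x : MemberY θ.d₆ θ.ℓ₆ θ.hd' θ.hL' θ.b₀ θ.b₁ Mstar)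
    (U : (bg9Y (Matrix (Fin N) (Fin N) ℂ) (specialUnitaryUnits (Fin N)) x).Cfg) (y y' : (geo9Y x).Site) :
    ((opsYOfRecord N θ Mstar 𝔈) x).QG1Qinv.ker U y y' = 0 := by
  have h1 : ((opsYOfRecord N θ Mstar 𝔈) x).QG1Qinv =
      siteKernelOfOp x.toKIdx (bg9Y (Matrix (Fin N) (Fin N) ℂ) (specialUnitaryUnits (Fin N)) x) (fun U => U)
        (lettersYOfRecord N θ Mstar x).QG1Qinv id id := rfl
  rw [h1, lettersYOfRecord_QG1Qinv]
  exact siteKernelOfOp_zero_ker x.toKIdx (bg9Y (Matrix (Fin N) (Fin N) ℂ) (specialUnitaryUnits (Fin N)) x) (fun U => U) id id U y y'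

/-- ★ **ROW 25 AT THE INSTANCE OF RECORD IS VACUOUS**: `s349 : B9.Stmt349Printed d′ c35 geo9Y (bg9Y …) (fun x => (opsYOfRecord N θ M⋆ 𝔈 x).P349)`
holds for every `d′`, `c35` BECAUSE THE LETTER `P` OF RECORD IS THE FLAT ZERO (def-Y v2, `Node00.OpsYDeltaA` §6: the Sect. D∕E letters remain the
`0` placeholders) — NOT Bałaban's (3.49): a LOCATED VACUITY, recorded so that no knit at `opsYOfRecord` presents row 25 as content.
[cite: Balaban1985BackgroundPropagators, (3.49) p.399 (statement shape; vacuity bookkeeping)] -/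
theorem s349_opsYOfRecord_vacuous (θ : Stage3Params) (Mstar : ℕ) (𝔈 : ExpsY N θ Mstar) (dd : ℕ) (c35 : ℝ) :
    B9.Stmt349Printed dd c35 (geo9Y (d := θ.d₆) (ℓ := θ.ℓ₆) (hd := θ.hd') (hL := θ.hL') (b₀ := θ.b₀) (b₁ := θ.b₁) (Mstar := Mstar))
      (bg9Y (Matrix (Fin N) (Fin N) ℂ) (specialUnitaryUnits (Fin N)))
      (fun x => ((opsYOfRecord N θ Mstar 𝔈) x).P349) :=
  stmt349Printed_of_ker_zero dd c35 _ (fun x n U y y' => opsYOfRecord_P349_ker θ Mstar 𝔈 x n U y y')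
    (fun x y => (geo9Y_len_pos x y).le)

/-- ★ **ROW 26 AT THE INSTANCE OF RECORD IS VACUOUS**: `s3132 : B9.Stmt3132Printed d′ c35 geo9Y (bg9Y …) (fun x => (opsYOfRecord … x).QGQinv)
(fun x => (opsYOfRecord … x).QG1Qinv)` holds for every `d′`, `c35` BECAUSE THE LETTERS `(QGQ*)⁻¹`, `(QG₁Q*)⁻¹` OF RECORD ARE THE FLAT ZEROS —
NOT Bałaban's (3.132): a LOCATED VACUITY (the non-vacuous route is `B9Eq3132RingInverseReading.stmt3132Printed_opsYOfLetters_of_ringInverse`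
once the letters are the constructed inverses). [cite: Balaban1985BackgroundPropagators, (3.132) p.422 (statement shape; vacuity bookkeeping)] -/
theorem s3132_opsYOfRecord_vacuous (θ : Stage3Params) (Mstar : ℕ) (𝔈 : ExpsY N θ Mstar) (dd : ℕ) (c35 : ℝ) :
    B9.Stmt3132Printed dd c35 (geo9Y (d := θ.d₆) (ℓ := θ.ℓ₆) (hd := θ.hd') (hL := θ.hL') (b₀ := θ.b₀) (b₁ := θ.b₁) (Mstar := Mstar))
      (bg9Y (Matrix (Fin N) (Fin N) ℂ) (specialUnitaryUnits (Fin N)))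
      (fun x => ((opsYOfRecord N θ Mstar 𝔈) x).QGQinv) (fun x => ((opsYOfRecord N θ Mstar 𝔈) x).QG1Qinv) :=
  stmt3132Printed_of_ker_zero dd c35 _ _ (fun x U y y' => opsYOfRecord_QGQinv_ker θ Mstar 𝔈 x U y y')
    (fun x U y y' => opsYOfRecord_QG1Qinv_ker θ Mstar 𝔈 x U y y') (fun x y => (geo9Y_len_pos x y).le)

end Record

end Literature.MathematicalPhysics.QuantumFieldTheory.Balaban1983to89.B9RecordDELettersVacuity

end
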